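import Summits.ResolutionOfSingularities.ResolutionOfSingularities.Theorems.HomologicalConductorNoZenoRFirstKindBaseCycle
import Summits.ResolutionOfSingularities.ResolutionOfSingularities.Theorems.HomologicalConductorNoZenoRKernelGenerated
import Literature.AlgebraicGeometry.Modules.SectionsExact
import HarnessLib

/-!
# Crux `NoZenoR` (stmt-ResolutionOfSingularities-19943) — `𝔪²` is CONTRACTED on a desingularization of a rational
# surface singularity, `ℓ(S/𝔪²) ≤ h⁰(𝒪_X/𝔪²𝒪_X)`, and a first-kind curve is NEVER the whole closed fibre when
# `ℓ(S/𝔪²) ≥ 4` (i.e. `S` not regular)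

Route `ResolutionOfSingularities/HomologicalConductor` (cell decomp-res, hand leafhand-res-homologicalconduct-24 g0).
OURS: AI-written proof over tree theorems, weaker than expert review; nothing here is a statement of the manuscript
under review (Hironaka 2017).  SUPPORT level, counted 0.  Def-free, fact-free.

Sequel of `…NoZenoRFirstKindBaseCycle` (dichotomy `(Z·E_η) = 0 ∨ 𝔪𝒪_X = 𝓘_η` for a first-kind curve `E_η` and the
cycle `Z` of `𝔪𝒪_X`, `S` rational non-regular).  The second alternative is excluded numerically:

* `sq_maximalIdeal_contracted` — **`𝔪²` is contracted** for every desingularization `π : X → Spec S` of a non-regular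
  rational `S` (`r ∈ 𝔪²𝒪_{X,x}` for all `x` ⇒ `r ∈ 𝔪²`): hand 22's Γ-generation `Γ(𝔪²𝒪_X) = Σ tᵢ Γ(𝔪𝒪_X)`
  (`QuadraticTransform.sections_generate_pow_succ`, from `Ȟ¹(ker Ψ₁) = 0`) fed into
  `QuadraticTransform.pow_succ_contracted_of_sections_generate` over the contractedness of `𝔪`;
* `length_quotient_sq_le_h0` — hence **`ℓ_S(S/𝔪²) ≤ h⁰(𝒪_X/𝔪²𝒪_X)`**: the kernel of `S → Γ(X, 𝒪_X/𝔪²𝒪_X)` consists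
  of the `r` with `algebraMapΓ r ∈ Γ(X, 𝔪²𝒪_X)` (sections are left exact), i.e. of the contraction of `𝔪²`, which is `𝔪²`;
* `baseIdeal_sq_eq` — `(𝔪𝒪_X)² = 𝔪²𝒪_X` as ideal sheaves;
* **`baseIdeal_ne_primeDivisorIdeal_of_firstKind`** — if `4 ≤ ℓ_S(S/𝔪²)` then `𝔪𝒪_X ≠ 𝓘_η` for every first-kind
  `E_η`: otherwise `h⁰(𝓘_η) = h⁰(𝒪_X/𝔪𝒪_X) ≤ 1` and `4 ≤ ℓ(S/𝔪²) ≤ h⁰(𝒪_X/𝔪²𝒪_X) = h⁰(𝓘_η²) = 3·h⁰(𝓘_η) ≤ 3`;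
* **`excCurveDegree_baseIdeal_eq_zero_of_firstKind`** — so, when `4 ≤ ℓ_S(S/𝔪²)`, EVERY first-kind curve has
  `(Z·E_η) = 0` (it is numerically contracted by the domination `X → Bl_𝔪 Spec S`).

The hypothesis `4 ≤ ℓ_S(S/𝔪²)` is `1 + dim_k 𝔪/𝔪² ≥ 4`, i.e. embedding dimension `≥ 3`, which holds for every
NON-regular two-dimensional Noetherian local ring (`Mathlib`: `IsRegularLocalRing.of_spanFinrank_maximalIdeal_le`);
that commutative-algebra bookkeeping is left to a sequel.  No crux or summit statement is proved here.
-/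

noncomputable section

-- single-problem summit: the doubled namespace component `ResolutionOfSingularities` is forced
set_option linter.dupNamespace false

open CategoryTheory CategoryTheory.Limits AlgebraicGeometry TopologicalSpace IsLocalRing
open Literature.AlgebraicGeometry.Resolution Literature.AlgebraicGeometry.Motives Literature.AlgebraicGeometry.Modules
open Literature.AlgebraicGeometry.Morphisms hiding algebraMapΓ
open Scheme.IdealSheafData

namespace Summit.ResolutionOfSingularities.ResolutionOfSingularities.Theorems.NoZeno.FirstKind

variable {S : Type} [CommRing S] [IsNoetherianRing S] [IsLocalRing S] [IsDomain S] [IsIntegrallyClosed S]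
  {X : Scheme.{0}} (π : X ⟶ Spec (.of S))

/-- **`𝔪²` is contracted** on every desingularization of a non-regular rational surface singularity: if
`r ∈ 𝔪²·𝒪_{X,x}` for every `x ∈ X` then `r ∈ 𝔪²` (Lipman (7.2) for `I = J = 𝔪`; here from hand 22's Γ-generation
`Γ(X, 𝔪²𝒪_X) = Σ tᵢ·Γ(X, 𝔪𝒪_X)` and the contractedness of `𝔪`).
[cite: Lipman1969, Theorem (7.2), Lemma (7.3) (pp. 209–211)] -/
theorem sq_maximalIdeal_contracted (hdim : ringKrullDim S = 2) (hrat : HasRationalSingularity S)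
    (hsing : ¬ IsRegularLocalRing S) (hπ : IsResolution π) (r : S)
    (hr : ∀ x : X, ExcCount.toStalk π x r ∈ (maximalIdeal S ^ 2).map (ExcCount.toStalk π x)) :
    r ∈ maximalIdeal S ^ 2 := by
  obtain ⟨s, t, ht⟩ := Submodule.fg_iff_exists_fin_generating_family.mp
    ((isNoetherianRing_iff_ideal_fg S).mp inferInstance (maximalIdeal S))
  have htm : ∀ i, t i ∈ maximalIdeal S := fun i => ht ▸ Ideal.subset_span ⟨i, rfl⟩
  have h1 : ∀ r : S, (∀ x : X, ExcCount.toStalk π x r ∈ (maximalIdeal S ^ 1).map (ExcCount.toStalk π x)) →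
      r ∈ maximalIdeal S ^ 1 := by
    intro r hr
    rw [pow_one]
    exact QuadraticTransform.mem_maximalIdeal_of_forall_toStalk_mem π hπ (by simpa only [pow_one] using hr)
  exact QuadraticTransform.pow_succ_contracted_of_sections_generate π hπ t htm 1 h1
    (fun y => QuadraticTransform.sections_generate_pow_succ π hdim hrat hsing hπ t (maximalIdeal S) rfl ht 1
      le_rfl y) r hr

/-- **`ℓ_S(S/𝔪²) ≤ h⁰(𝒪_X/𝔪²𝒪_X)`** on a desingularization of a non-regular rational surface singularity: the
`S`-linear map `S → Γ(X, 𝒪_X/𝔪²𝒪_X)`, `a ↦ a·1`, has kernel contained in `𝔪²` — an `a` in the kernel has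
`algebraMapΓ a ∈ Γ(X, 𝔪²𝒪_X)` (sections of `0 → 𝔪²𝒪_X → 𝒪_X → 𝒪_X/𝔪²𝒪_X → 0` are left exact), hence lies in the
contraction of `𝔪²`, which is `𝔪²` — so `S/𝔪² ↞ S/ker ↪ Γ(X, 𝒪_X/𝔪²𝒪_X)`.
[cite: Lipman1969, Theorem (7.2) (p. 209); Definition (6.1) (pp. 207–208)] -/
theorem length_quotient_sq_le_h0 (hdim : ringKrullDim S = 2) (hrat : HasRationalSingularity S)
    (hsing : ¬ IsRegularLocalRing S) (hπ : IsResolution π) :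
    Module.length S (S ⧸ maximalIdeal S ^ 2) ≤
      h0 π (Scheme.IdealSheafData.ofIdealTop ((maximalIdeal S ^ 2).map
        (Literature.AlgebraicGeometry.Morphisms.algebraMapΓ π))) := by
  set J := Scheme.IdealSheafData.ofIdealTop ((maximalIdeal S ^ 2).map
    (Literature.AlgebraicGeometry.Morphisms.algebraMapΓ π)) with hJ
  rw [h0_eq_length_MSections_idealQuot]
  let q : MSections π (unitModule X) ⊤ →ₗ[S] MSections π (idealQuot (unitModule X) J) ⊤ :=
    MSections.app π (idealQuotπ (unitModule X) J) ⊤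
  let e : MSections π (idealQuot (unitModule X) J) ⊤ := q (show MSections π (unitModule X) ⊤ from (1 : Γ(X, ⊤)))
  let ψ : S →ₗ[S] MSections π (idealQuot (unitModule X) J) ⊤ := LinearMap.toSpanSingleton S _ e
  have hker : LinearMap.ker ψ ≤ (maximalIdeal S ^ 2 : Ideal S) := by
    intro a ha
    rw [LinearMap.mem_ker, LinearMap.toSpanSingleton_apply] at ha
    have ha' : q (show MSections π (unitModule X) ⊤ from
        Literature.AlgebraicGeometry.Morphisms.algebraMapΓ π a) = 0 := by
      rw [← QuadraticTransform.smul_one_MSections_unit, map_smul]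
      exact ha
    -- left exactness of global sections
    obtain ⟨m, hm⟩ := (sections_exact_of_shortExact (shortExact_idealMul (unitModule X) J) ⊤).2 _ ha'
    exact sq_maximalIdeal_contracted π hdim hrat hsing hπ a
      ((QuadraticTransform.forall_toStalk_mem_iff_exists_idealMulι_app_eq π (maximalIdeal S ^ 2) a).mpr ⟨m, hm⟩)
  calc Module.length S (S ⧸ maximalIdeal S ^ 2)
      ≤ Module.length S (S ⧸ LinearMap.ker ψ) :=
        Module.length_le_of_surjective (Submodule.factor hker) (Submodule.factor_surjective hker)
    _ = Module.length S (LinearMap.range ψ) := (LinearMap.quotKerEquivRange ψ).length_eq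
    _ ≤ Module.length S (MSections π (idealQuot (unitModule X) J) ⊤) :=
        Module.length_le_of_injective _ (Submodule.subtype_injective _)

omit [IsNoetherianRing S] [IsDomain S] [IsIntegrallyClosed S] in
/-- `(𝔪𝒪_X)² = 𝔪²𝒪_X` as ideal sheaves (chartwise `Ideal.map_pow`). [folklore] -/
theorem baseIdeal_sq_eq :
    Scheme.IdealSheafData.ofIdealTop ((maximalIdeal S).map
        (Literature.AlgebraicGeometry.Morphisms.algebraMapΓ π)) ^ 2 =
      Scheme.IdealSheafData.ofIdealTop ((maximalIdeal S ^ 2).map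
        (Literature.AlgebraicGeometry.Morphisms.algebraMapΓ π)) := by
  refine Scheme.IdealSheafData.ext (funext fun V => ?_)
  rw [Scheme.IdealSheafData.ideal_pow, Pi.pow_apply, QuadraticTransform.ofIdealTop_map_pow_ideal]

/-- **A first-kind curve is never the whole closed fibre when `ℓ_S(S/𝔪²) ≥ 4`**: for `S` rational non-regular with
`4 ≤ ℓ_S(S/𝔪²)` (embedding dimension `≥ 3`), `π : X → Spec S` a desingularization and `E_η` of the first kind,
`𝔪𝒪_X ≠ 𝓘_η` — otherwise `h⁰(𝓘_η) = h⁰(𝒪_X/𝔪𝒪_X) ≤ 1` and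
`4 ≤ ℓ(S/𝔪²) ≤ h⁰(𝒪_X/𝔪²𝒪_X) = h⁰(𝓘_η²) = 3·h⁰(𝓘_η) ≤ 3`.
[cite: Lipman1969, Proposition (3.1) (p. 203); Theorem (7.2) (p. 209)] -/
theorem baseIdeal_ne_primeDivisorIdeal_of_firstKind (hdim : ringKrullDim S = 2)
    (hrat : HasRationalSingularity S) (hsing : ¬ IsRegularLocalRing S) (hπ : IsResolution π)
    (hlen : 4 ≤ Module.length S (S ⧸ maximalIdeal S ^ 2)) {η : X}
    (hfk : h0 π (primeDivisorIdeal η ^ 2) = 3 * h0 π (primeDivisorIdeal η)) :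
    Scheme.IdealSheafData.ofIdealTop ((maximalIdeal S).map
        (Literature.AlgebraicGeometry.Morphisms.algebraMapΓ π)) ≠ primeDivisorIdeal η := by
  intro heq
  have hle : h0 π (primeDivisorIdeal η) ≤ 1 := by
    rw [← heq]
    exact QuadraticTransform.h0_baseIdeal_maximalIdeal_le_one π hdim hrat hπ
  have hsq : h0 π (Scheme.IdealSheafData.ofIdealTop ((maximalIdeal S ^ 2).map
      (Literature.AlgebraicGeometry.Morphisms.algebraMapΓ π))) = 3 * h0 π (primeDivisorIdeal η) := by
    rw [← baseIdeal_sq_eq, heq, hfk]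
  have h4 : (4 : ℕ∞) ≤ 3 * h0 π (primeDivisorIdeal η) :=
    hlen.trans (hsq ▸ length_quotient_sq_le_h0 π hdim hrat hsing hπ)
  have h3 : 3 * h0 π (primeDivisorIdeal η) ≤ 3 * 1 := by gcongr
  have := h4.trans h3
  exact absurd this (by decide)

/-- **Every first-kind curve is numerically contracted by `X → Bl_𝔪 Spec S`** (`S` rational, non-regular, with
`4 ≤ ℓ_S(S/𝔪²)`): for the cycle `Z` of `𝔪𝒪_X` and `E_η` of the first kind, `(Z·E_η) = 0` — the dichotomy
`excCurveDegree_baseIdeal_eq_zero_or_eq_of_firstKind` with its second alternative excluded by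
`baseIdeal_ne_primeDivisorIdeal_of_firstKind`. [cite: Lipman1969, Proposition (3.1) (p. 203); Proposition (13.1) (p. 223)] -/
theorem excCurveDegree_baseIdeal_eq_zero_of_firstKind [IsIntegral X] [IsLocallyNoetherian X]
    (hdim : ringKrullDim S = 2) (hrat : HasRationalSingularity S) (hsing : ¬ IsRegularLocalRing S)
    (hπ : IsResolution π) (hlen : 4 ≤ Module.length S (S ⧸ maximalIdeal S ^ 2))
    {η : X} (hη : η ∈ excCurvePoints π)
    (hfk : h0 π (primeDivisorIdeal η ^ 2) = 3 * h0 π (primeDivisorIdeal η))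
    (hJ : IsEffectiveCartier (Scheme.IdealSheafData.ofIdealTop ((maximalIdeal S).map
      (Literature.AlgebraicGeometry.Morphisms.algebraMapΓ π)))) :
    excCurveDegree π (CartierDivisor.ofIsEffectiveCartier _ hJ) η = 0 := by
  rcases excCurveDegree_baseIdeal_eq_zero_or_eq_of_firstKind π hdim hrat hsing hπ hη hfk hJ with h | h
  · exact h
  · exact absurd h (baseIdeal_ne_primeDivisorIdeal_of_firstKind π hdim hrat hsing hπ hlen hfk)

end Summit.ResolutionOfSingularities.ResolutionOfSingularities.Theorems.NoZeno.FirstKind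

end
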